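import Literature.MathematicalPhysics.QuantumFieldTheory.Balaban1983to89.B15Prop1ChartPointCriticalityFromMinimiser
import Literature.MathematicalPhysics.QuantumFieldTheory.Balaban1983to89.B15Prop1DatumCoordinatesTower

/-!
# `Balaban1983to89.B15Prop1ChartPointCriticalityFromMinimiserTower` — [Balaban1985Variational] = «[15]», Prop. 8 p. 305, p. 278, Sect. C (47)–(49) p. 285, (82)–(83) p. 290, Sect. F
# p. 300, (181) p. 307; [Balaban1988Convergent] (2.10)–(2.12) p. 256; [LuenbergerYe2008] §10.7, §11.3: THE LETTER (P8) — a (2.12) minimiser near the base state is constrained-critical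
# in the base field's chart — UNDER THE PER-TOWER (0.4) GUARDS; the «TP» twin of `B15Prop1ChartPointCriticalityFromMinimiser` (LOCATED-E1-HSB repair step (r3), link 7∕9)

Honest framing: statement-level skeleton of published theorems with citation tags; proofs where landed; nothing here is a claim about the
Yang–Mills mass gap.  Cell `pub-ymgap`, HUMAN RULING D-0062 (Track A), seat `pub-ymgap-dag-n12-c` g24 (lane owner N12 = [B15], strategy s1; lane memo `N12-UNIFORMITY-SPEC.md` §6,
plan g91 word pub-ymgap INBOX l.45435 «(r3) = ADDITIVE TP-twins»); count-neutral; N12 NOT discharged; finite 𝕋⁴ at fixed ε; nothing continuum ∕ OS ∕ mass-gap ∕ Clay.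

WHAT CHANGES AGAINST THE TWIN (dag-n12-w1 g3's `hP8_of_honto`, untouched).  `hsbU : SmallBelow k U₀` ↦ the ENUMERATED per-tower guards `hgU` at the constrained bonds of `𝔹`
(+ `hk : k ≤ m + K`); the guards of the NEARBY configurations (the set `O` of good matrix fields) are the per-tower ones delivered by `B15Prop1DatumCoordinatesTower.eventually_guardOn_constr`
(twin of `eventually_smallBelow`), and the fibre injectivity at two nearby points is `agreeOn_of_datumCoord_eq_of_guardOn`; proof otherwise VERBATIM.  The helpers
(`eq_of_conj_fixed_of_re_eq`, `star_mul_inv_eq_of_SU`, `eventually_conjVec_eq_self_of_expMulC_eq_coeField`, `eventually_surjective_fderiv`) are the twin's.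

CONTENTS (theorems only; no `def`, no `instance`, no `sorry`).  ★★★ `hP8_of_honto_of_guardOn`.
-/

noncomputable section

namespace Literature.MathematicalPhysics.QuantumFieldTheory.Balaban1983to89.B15Prop1ChartPointCriticalityFromMinimiserTower

open Set Metric Filter
open scoped Topology ContDiff ComplexConjugate
open Literature.Analysis.Calculus.ConstrainedCriticalFamily (symm_equivariant symm_eventuallyEq fderiv_symm_eq fderiv_conj_of_equivariant fderiv_conj_of_equivariant_scalar
  killsKer_of_real exists_multiplier_of_killsKer)
open Literature.Analysis.Calculus.LagrangeHessianRealCoercive (conj_fix_rePart)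
open Literature.MathematicalPhysics.QuantumFieldTheory.Balaban1983to89.Node00 (SU coeField coeField_apply SmallBelow ConstrSet constrCard constrEnum exists_hasDerivAt_curve_of_mem_ker
  star_coe_mul_coe_SU coe_mul_star_coe_SU)
open B15AveragingHolomorphic (iterMh)
open B15ComplexifiedDatumFamily (conjVec conjVec_cplxVec)
open B15SU2ChartHolomorphic (genE expPointC expMulC logCoordC logCoordC_expPointC star_expPointC_inv)
open B15Prop1StateChartSU2 (exists_conjCLM exists_conjCLM_pi conjVec_conjVec conjVec_eq_self_iff expMulC_conjVec_coeField det_expMulC_coeField analyticAt_expMulC_right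
  expMulC_cplxVec_coeField_eq)
open B15Prop1DatumCoordinates (expMulC_zero_left)
open B15Prop1DatumCoordinatesTower (eventually_analyticAt_datumCoord_of_guardOn eventually_datumCoord_real_of_guardOn eventually_datumCoord_theta_of_guardOn
  eventually_norm_rel_sub_one_lt_of_guardOn eventually_guardOn_constr agreeOn_of_datumCoord_eq_of_guardOn)
open B15Prop1ChartPointCriticalityFromMinimiser (eq_of_conj_fixed_of_re_eq star_mul_inv_eq_of_SU eventually_conjVec_eq_self_of_expMulC_eq_coeField eventually_surjective_fderiv)
open B15Prop1ComplexWilsonAction (analyticAt_actionSum_expMulC actionSum_expMulC_conjVec actionSum_expMulC_cplxVec)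
open B15Prop1LocalChartAtBaseField (exists_conjCLM_submodule)
open B15Prop1ClassOpenAtRecord (isInducing_coeField)
open B15Prop1HessianNondegenerateOfRealCoercive (cplxVec_add cplxVec_smul)
open B15Prop1BaseCriticalityFromMinimiser (exists_cplxVecCLM exists_reVecCLM)
open B15Prop1AnalyticExtClause (cplxVec)
open B15Prop1ChartCalculusSU2 (E3)
open B15Prop1ChartSU2 (su2Chart)
open B16Sect1Backgrounds (expMul expMul_zero)
open ExpMeanLog (expMeanLogSU)
open BlockAveraging (blockAvg)
open T4CubeChartGnomonic (SU2)
open T4Continuum B15DeterminingSets GaugeField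
open scoped Matrix.Norms.L2Operator

variable {P : Params}

/-! ## §1  Plumbing: reality of chart points with unitary values; openness of surjectivity -/


/-! ## §2  The letter (P8): a minimiser at a chart point near `0` is Lagrange-critical in the base field's slice coordinates -/

section P8

/-- ★★★ **THE LETTER (P8) FROM `honto` AND THE OPENNESS OF THE CLASS.**  In the setting of `exists_localChart_at_baseField` (base state `U₀` guarded below `k` on the fibre of the base
datum `Q₀`, conjugation-stable slice `S`, slice action `a`, slice datum coordinates `Φ₀` referenced to `Ū(Q₀)`, `DΦ₀(0)` onto, the class `reg` open at `U₀` in matrix form): for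
every `x` near `0` in `S` and every `SU(2)` configuration `U'` with `exp(x)·↑U₀ = ↑U'` that is a (2.12) MINIMISER over `reg` for its own datum `Ū(U')`, the slice action is
constrained-critical at `x` in Lagrange form: `Da(x) = μ ∘ DΦ₀(x)` for some `μ` — print's Prop. 8 («a solution of the variational problem is a critical configuration») read in the
base field's chart; the binder (P8) of `B15Prop1LocalChartFromThm1AtBase.hcritT_isMinimizer_of_thm1AtBase`. [cite: Balaban1985Variational, Prop. 8 p.305, p.278, Sect. C (47)–(49) p.285, (82)–(83) p.290, Sect. F p.300, (181) p.307; Balaban1988Convergent, (2.12) p.256; LuenbergerYe2008, §10.7 pp.306–307, §11.3] -/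
theorem hP8_of_honto_of_guardOn (𝔹 : DetSet P) (k : ℕ) (h𝔹 : ∀ j, k < j → 𝔹 j = ∅) (hk : k ≤ P.m + P.K) (reg : Set (GaugeField P 0 SU2))
    {Q₀ U₀ : GaugeField P 0 SU2}
    (hgU : ∀ i : Fin (constrCard 𝔹 k), ∀ j', j' < (((constrEnum 𝔹 k).symm i).1 : ℕ) → ∀ c' : PBond P (j' + 1),
      c' ∈ B10Eq42TorusConstraint.bondsIn (j' + 1) (B14.Eq22Determines.blockIter (((constrEnum 𝔹 k).symm i).1 : ℕ) ⁻¹'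
        ({((constrEnum 𝔹 k).symm i).2.1.src, ((constrEnum 𝔹 k).symm i).2.1.tgt} : Set (Site P ((constrEnum 𝔹 k).symm i).1))) →
        BlockAveraging.Small expMeanLogSU (Averaging.iter (fun j => blockAvg (P := P) (j := j) expMeanLogSU) j' U₀) c')
    (hU₀ : AgreeOn 𝔹 (avgFamily (fun j => blockAvg (P := P) (j := j) expMeanLogSU) U₀) (avgFamily (fun j => blockAvg (P := P) (j := j) expMeanLogSU) Q₀))
    (S : Submodule ℂ (VecField P 0 (EuclideanSpace ℂ (Fin 3)))) (hS : ∀ X ∈ S, conjVec X ∈ S)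
    (a : S → ℂ)
    (ha : ∀ X : S, a X = ∑ p : Plaq P 0, (1 - (expMulC (X : VecField P 0 (EuclideanSpace ℂ (Fin 3))) (coeField U₀) ⟨p.src, p.μ⟩ *
      expMulC (X : VecField P 0 (EuclideanSpace ℂ (Fin 3))) (coeField U₀) ⟨p.src.shift p.μ, p.ν⟩ *
      Matrix.adjugate (expMulC (X : VecField P 0 (EuclideanSpace ℂ (Fin 3))) (coeField U₀) ⟨p.src.shift p.ν, p.μ⟩) *
      Matrix.adjugate (expMulC (X : VecField P 0 (EuclideanSpace ℂ (Fin 3))) (coeField U₀) ⟨p.src, p.ν⟩)).trace / 2))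
    (Φ₀ : S → Fin (constrCard 𝔹 k) → EuclideanSpace ℂ (Fin 3))
    (hΦ₀ : ∀ (X : S) i, Φ₀ X i = logCoordC (star ((avgFamily (fun j => blockAvg (P := P) (j := j) expMeanLogSU) Q₀ ((constrEnum 𝔹 k).symm i).1
      ((constrEnum 𝔹 k).symm i).2.1 : SU2) : Matrix (Fin 2) (Fin 2) ℂ) *
      iterMh ((constrEnum 𝔹 k).symm i).1 (expMulC (X : VecField P 0 (EuclideanSpace ℂ (Fin 3))) (coeField U₀)) ((constrEnum 𝔹 k).symm i).2.1))
    (honto : Function.Surjective (fderiv ℂ Φ₀ 0))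
    (hclass : ∀ᶠ Q in 𝓝 (coeField U₀), ∀ U' : GaugeField P 0 SU2, coeField U' = Q → U' ∈ reg) :
    ∀ᶠ x in 𝓝 (0 : S), ∀ U' : GaugeField P 0 SU2, expMulC ((x : S) : VecField P 0 (EuclideanSpace ℂ (Fin 3))) (coeField U₀) = coeField U' →
      IsMinimizer (fun j => blockAvg (P := P) (j := j) expMeanLogSU) reg 𝔹 (avgFamily (fun j => blockAvg (P := P) (j := j) expMeanLogSU) U') U' →
        ∃ μ : (Fin (constrCard 𝔹 k) → EuclideanSpace ℂ (Fin 3)) →L[ℂ] ℂ, fderiv ℂ a x = μ.comp (fderiv ℂ Φ₀ x) := by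
  -- abbreviations and the base facts (as in `hcrit_of_isMinimizer`)
  set av : ∀ j, Averaging P j SU2 := fun j => blockAvg (P := P) (j := j) expMeanLogSU with hav
  set W : MSField P SU2 := avgFamily av Q₀ with hW
  obtain ⟨cE, hcE, hcEinv⟩ := exists_conjCLM_submodule S hS
  obtain ⟨cF, hcF, hcFinv⟩ := exists_conjCLM_pi (Fin (constrCard 𝔹 k))
  set κ : (PBond P 0 → Matrix (Fin 2) (Fin 2) ℂ) → Fin (constrCard 𝔹 k) → EuclideanSpace ℂ (Fin 3) := fun Q i =>
    logCoordC (star ((W ((constrEnum 𝔹 k).symm i).1 ((constrEnum 𝔹 k).symm i).2.1 : SU2) : Matrix (Fin 2) (Fin 2) ℂ) *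
      iterMh ((constrEnum 𝔹 k).symm i).1 Q ((constrEnum 𝔹 k).symm i).2.1) with hκdef
  have hκ : ∀ Q i, κ Q i = logCoordC (star ((W ((constrEnum 𝔹 k).symm i).1 ((constrEnum 𝔹 k).symm i).2.1 : SU2) : Matrix (Fin 2) (Fin 2) ℂ) *
      iterMh ((constrEnum 𝔹 k).symm i).1 Q ((constrEnum 𝔹 k).symm i).2.1) := fun Q i => rfl
  set χ : S → PBond P 0 → Matrix (Fin 2) (Fin 2) ℂ := fun X => expMulC (X : VecField P 0 (EuclideanSpace ℂ (Fin 3))) (coeField U₀) with hχdef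
  have hχ0 : χ 0 = coeField U₀ := by
    show expMulC ((0 : S) : VecField P 0 (EuclideanSpace ℂ (Fin 3))) (coeField U₀) = coeField U₀
    rw [Submodule.coe_zero, expMulC_zero_left]
  have hχan : ∀ X : S, AnalyticAt ℂ χ X := fun X => (analyticAt_expMulC_right (coeField U₀) _).comp (S.subtypeL.analyticAt X)
  have hχt : Tendsto χ (𝓝 0) (𝓝 (coeField U₀)) := by
    have h := (hχan 0).continuousAt.tendsto; rwa [hχ0] at h
  have hχθ : ∀ (X : S) b, χ (cE X) b = (star (χ X b))⁻¹ := fun X b => by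
    show expMulC ((cE X : S) : VecField P 0 (EuclideanSpace ℂ (Fin 3))) (coeField U₀) b = _
    rw [hcE]; exact expMulC_conjVec_coeField U₀ _ b
  have hχdet : ∀ (X : S) b, (χ X b).det = 1 := fun X b => det_expMulC_coeField U₀ _ b
  have hΦ₀κ : ∀ X : S, Φ₀ X = κ (χ X) := fun X => funext fun i => by rw [hΦ₀, hκ]
  have hcoeinj : ∀ U V : GaugeField P 0 SU2, coeField U = coeField V → U = V := fun U V h =>
    funext fun b => Subtype.ext (by simpa only [coeField_apply] using congrFun h b)
  -- local equivariance of `Φ₀`, its symmetrisation `Φ`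
  have hκθ : ∀ᶠ Q in 𝓝 (coeField U₀), (∀ b, IsUnit (Q b).det) → κ (fun b => (star (Q b))⁻¹) = cF (κ Q) :=
    eventually_datumCoord_theta_of_guardOn 𝔹 k hk W κ hκ hgU hU₀ cF hcF
  have hloc : ∀ᶠ X in 𝓝 (0 : S), Φ₀ (cE X) = cF (Φ₀ X) := by
    filter_upwards [hχt.eventually hκθ] with X hX
    rw [hΦ₀κ, hΦ₀κ]
    rw [show χ (cE X) = fun b => (star (χ X b))⁻¹ from funext (hχθ X)]
    exact hX fun b => by rw [hχdet]; exact isUnit_one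
  set Φ : S → Fin (constrCard 𝔹 k) → EuclideanSpace ℂ (Fin 3) := fun X => (2 : ℂ)⁻¹ • (Φ₀ X + cF (Φ₀ (cE X))) with hΦdef
  have hΦs : ∀ X, Φ X = (2 : ℂ)⁻¹ • (Φ₀ X + cF (Φ₀ (cE X))) := fun X => rfl
  have hΦE : ∀ X, Φ (cE X) = cF (Φ X) := symm_equivariant cE cF hcEinv hcFinv hΦs
  -- analyticity of `a` everywhere and of `κ` near `↑U₀`; conjugation symmetry of `a`
  have haan : ∀ X : S, AnalyticAt ℂ a X := fun X => by
    have hfun : a = fun X : S => ∑ p : Plaq P 0, (1 - (expMulC (X : VecField P 0 (EuclideanSpace ℂ (Fin 3))) (coeField U₀) ⟨p.src, p.μ⟩ *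
        expMulC (X : VecField P 0 (EuclideanSpace ℂ (Fin 3))) (coeField U₀) ⟨p.src.shift p.μ, p.ν⟩ *
        Matrix.adjugate (expMulC (X : VecField P 0 (EuclideanSpace ℂ (Fin 3))) (coeField U₀) ⟨p.src.shift p.ν, p.μ⟩) *
        Matrix.adjugate (expMulC (X : VecField P 0 (EuclideanSpace ℂ (Fin 3))) (coeField U₀) ⟨p.src, p.ν⟩)).trace / 2) := funext ha
    rw [hfun]
    exact (analyticAt_actionSum_expMulC (P := P) (j := 0) (A := fun W => ∑ p : Plaq P 0, (1 - (W ⟨p.src, p.μ⟩ * W ⟨p.src.shift p.μ, p.ν⟩ *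
      Matrix.adjugate (W ⟨p.src.shift p.ν, p.μ⟩) * Matrix.adjugate (W ⟨p.src, p.ν⟩)).trace / 2)) (fun _ => rfl) U₀ _).comp (S.subtypeL.analyticAt X)
  have haE : ∀ X : S, a (cE X) = conj (a X) := fun X => by
    rw [ha, ha, hcE]
    exact actionSum_expMulC_conjVec (A := fun W => ∑ p : Plaq P 0, (1 - (W ⟨p.src, p.μ⟩ * W ⟨p.src.shift p.μ, p.ν⟩ *
      Matrix.adjugate (W ⟨p.src.shift p.ν, p.μ⟩) * Matrix.adjugate (W ⟨p.src, p.ν⟩)).trace / 2)) (fun _ => rfl) U₀ _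
  have hκan : ∀ᶠ Q in 𝓝 (coeField U₀), AnalyticAt ℂ κ Q := eventually_analyticAt_datumCoord_of_guardOn 𝔹 k hk W κ hκ hgU hU₀
  have hΦ₀an : AnalyticAt ℂ Φ₀ 0 := by
    have hfun : Φ₀ = fun X => κ (χ X) := funext hΦ₀κ
    rw [hfun]
    have h1 : AnalyticAt ℂ κ (χ 0) := by rw [hχ0]; exact hκan.self_of_nhds
    exact h1.comp (hχan 0)
  -- the good open set around `↑U₀`: class, guard, relative closeness, reality of the coordinates, analyticity of `κ`
  have hG : {Q : PBond P 0 → Matrix (Fin 2) (Fin 2) ℂ | (∀ U : GaugeField P 0 SU2, coeField U = Q → U ∈ reg) ∧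
      (∀ U : GaugeField P 0 SU2, coeField U = Q → ∀ i : Fin (constrCard 𝔹 k), ∀ j', j' < (((constrEnum 𝔹 k).symm i).1 : ℕ) → ∀ c' : PBond P (j' + 1),
        c' ∈ B10Eq42TorusConstraint.bondsIn (j' + 1) (B14.Eq22Determines.blockIter (((constrEnum 𝔹 k).symm i).1 : ℕ) ⁻¹'
          ({((constrEnum 𝔹 k).symm i).2.1.src, ((constrEnum 𝔹 k).symm i).2.1.tgt} : Set (Site P ((constrEnum 𝔹 k).symm i).1))) →
          BlockAveraging.Small expMeanLogSU (Averaging.iter (fun j => blockAvg (P := P) (j := j) expMeanLogSU) j' U) c') ∧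
      (∀ i : Fin (constrCard 𝔹 k), ‖star ((W ((constrEnum 𝔹 k).symm i).1 ((constrEnum 𝔹 k).symm i).2.1 : SU2) : Matrix (Fin 2) (Fin 2) ℂ) *
        iterMh ((constrEnum 𝔹 k).symm i).1 Q ((constrEnum 𝔹 k).symm i).2.1 - 1‖ < 1 / 3) ∧
      (∀ Q' : GaugeField P 0 SU2, coeField Q' = Q → cF (κ Q) = κ Q) ∧ AnalyticAt ℂ κ Q} ∈ 𝓝 (coeField U₀) := by
    filter_upwards [hclass, eventually_guardOn_constr 𝔹 k hk hgU, eventually_norm_rel_sub_one_lt_of_guardOn 𝔹 k hk W hgU hU₀ (by norm_num : (0 : ℝ) < 1 / 3),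
      eventually_datumCoord_real_of_guardOn 𝔹 k hk W κ hκ hgU hU₀ cF hcF, hκan] with Q h1 h2 h3' h4 h5
    exact ⟨h1, h2, h3', h4, h5⟩
  obtain ⟨O, hOG, hOopen, hU₀O⟩ := _root_.mem_nhds_iff.1 hG
  -- the eventual sets in the chart point
  have hDΦc : ContinuousAt (fun x => fderiv ℂ Φ₀ x) 0 :=
    ((hΦ₀an.contDiffAt (n := (1 : WithTop ℕ∞) + 1)).fderiv_right (m := 1) le_rfl).continuousAt
  have e1 : ∀ᶠ x in 𝓝 (0 : S), ∀ᶠ y in 𝓝 x, Φ₀ (cE y) = cF (Φ₀ y) := hloc.eventually_nhds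
  have e2 : ∀ᶠ x in 𝓝 (0 : S), χ x ∈ O := hχt.eventually (hOopen.mem_nhds hU₀O)
  have e3 : ∀ᶠ x in 𝓝 (0 : S), Function.Surjective (fderiv ℂ Φ₀ x) := eventually_surjective_fderiv hDΦc honto
  have e4 : ∀ᶠ x in 𝓝 (0 : S), ∀ U' : GaugeField P 0 SU2, expMulC ((x : S) : VecField P 0 (EuclideanSpace ℂ (Fin 3))) (coeField U₀) = coeField U' →
      conjVec ((x : S) : VecField P 0 (EuclideanSpace ℂ (Fin 3))) = x := by
    have ht : Tendsto (fun x : S => (x : VecField P 0 (EuclideanSpace ℂ (Fin 3)))) (𝓝 0) (𝓝 0) := by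
      simpa only [Submodule.coe_zero] using (continuous_subtype_val.tendsto (0 : S))
    exact ht.eventually (eventually_conjVec_eq_self_of_expMulC_eq_coeField U₀)
  filter_upwards [e1, e2, e3, e4] with x hlocx hxO hontox hrealx U' hχU' hmin'
  -- ===== at the chart point `x`: reality, analyticity, equivariance of the derivatives =====
  have hxfix : cE x = x := Subtype.ext (by rw [hcE]; exact hrealx U' hχU')
  obtain ⟨hregx, hsbx, hrelx, hrealκx, hκanx⟩ := hOG hxO
  have hΦ₀anx : AnalyticAt ℂ Φ₀ x := by
    have hfun : Φ₀ = fun X => κ (χ X) := funext hΦ₀κ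
    rw [hfun]; exact hκanx.comp (hχan x)
  have hΦeq : Φ =ᶠ[𝓝 x] Φ₀ := symm_eventuallyEq cE cF hcFinv hΦs hlocx
  have hD1 : fderiv ℂ Φ x = fderiv ℂ Φ₀ x := fderiv_symm_eq cE cF hcFinv hΦs hlocx
  have hLeq : ∀ s : S, fderiv ℂ Φ₀ x (cE s) = cF (fderiv ℂ Φ₀ x s) := fun s => by
    have h := fderiv_conj_of_equivariant cE cF hcEinv hcFinv hΦE (x := x) (hΦ₀anx.differentiableAt.congr_of_eventuallyEq hΦeq)
    rw [hxfix, hD1] at h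
    have h' := congrArg (fun φ : S →L[ℂ] (Fin (constrCard 𝔹 k) → EuclideanSpace ℂ (Fin 3)) => φ (cE s)) h
    simp only [ContinuousLinearMap.coe_comp, Function.comp_apply, hcEinv] at h'
    exact h'
  have hlameq : ∀ s : S, fderiv ℂ a x (cE s) = conj (fderiv ℂ a x s) := fun s => by
    have h := fderiv_conj_of_equivariant_scalar cE hcEinv haE (x := x) (haan x).differentiableAt
    rw [hxfix] at h
    have h' := congrArg (fun φ : S →L[ℂ] ℂ => φ (cE s)) h
    simp only [ContinuousLinearMap.coe_comp, Function.comp_apply, ContinuousLinearEquiv.coe_coe, starL_apply, Complex.star_def, hcEinv] at h'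
    exact h'
  -- the configuration at the chart point is `U'`
  have hχU : χ x = coeField U' := hχU'
  -- ===== the real kernel directions are killed by `Da(x)` (real IFT on the real slice through `x` + Fermat) =====
  have hrealker : ∀ u : S, cE u = u → fderiv ℂ Φ₀ x u = 0 → fderiv ℂ a x u = 0 := by
    intro u hufix huker
    -- the REAL slice `Sr = {p : real bond fields | cplxVec p ∈ S}` and its inclusion `jS : Sr →L[ℝ] S`
    obtain ⟨ιc, hιc⟩ := exists_cplxVecCLM (P := P)
    let Sr : Submodule ℝ (VecField P 0 E3) := (S.restrictScalars ℝ).comap (ιc : VecField P 0 E3 →ₗ[ℝ] VecField P 0 (EuclideanSpace ℂ (Fin 3)))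
    have hmemSr : ∀ p : VecField P 0 E3, p ∈ Sr ↔ cplxVec p ∈ S := fun p => by
      show ιc p ∈ S.restrictScalars ℝ ↔ _
      rw [hιc]; rfl
    haveI : CompleteSpace (↥Sr) := FiniteDimensional.complete ℝ (↥Sr)
    let jS : Sr →L[ℝ] S := LinearMap.toContinuousLinearMap
      { toFun := fun p => ⟨cplxVec (p : VecField P 0 E3), (hmemSr p).1 p.2⟩
        map_add' := fun p q => by apply Subtype.ext; simp [cplxVec_add]
        map_smul' := fun r p => by
          apply Subtype.ext
          simp only [Submodule.coe_smul, RingHom.id_apply]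
          rw [cplxVec_smul, Complex.coe_smul]
          rfl }
    have hjS : ∀ p : Sr, ((jS p : S) : VecField P 0 (EuclideanSpace ℂ (Fin 3))) = cplxVec (p : VecField P 0 E3) := fun p => rfl
    -- a real vector of `S` is `jS` of a real bond field in `Sr`
    have hlift : ∀ w : S, cE w = w → ∃ p : Sr, jS p = w := by
      intro w hw
      have hfix : conjVec (w : VecField P 0 (EuclideanSpace ℂ (Fin 3))) = (w : VecField P 0 (EuclideanSpace ℂ (Fin 3))) := by
        rw [← hcE]; exact congrArg Subtype.val hw
      obtain ⟨p, hp⟩ := (conjVec_eq_self_iff _).1 hfix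
      have hpS : p ∈ Sr := (hmemSr p).2 (by rw [← hp]; exact w.2)
      exact ⟨⟨p, hpS⟩, Subtype.ext (by rw [hjS]; exact hp.symm)⟩
    obtain ⟨px, hpx⟩ := hlift x hxfix
    -- real parts of the constraint coordinates; the real constraint map on the real slice and its strict derivative at the real lift `px` of `x`
    obtain ⟨ρ, hρ⟩ := exists_reVecCLM (Fin (constrCard 𝔹 k))
    let f : Sr → (Fin (constrCard 𝔹 k) → EuclideanSpace ℝ (Fin 3)) := fun y => ρ (Φ₀ (jS y))
    let f' : Sr →L[ℝ] (Fin (constrCard 𝔹 k) → EuclideanSpace ℝ (Fin 3)) := ρ.comp (((fderiv ℂ Φ₀ x).restrictScalars ℝ).comp jS)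
    have hf : HasStrictFDerivAt f f' px := by
      have h1 : HasStrictFDerivAt Φ₀ ((fderiv ℂ Φ₀ x).restrictScalars ℝ) (jS px) := by
        rw [hpx]
        exact ((hΦ₀anx.contDiffAt (n := 1)).hasStrictFDerivAt one_ne_zero).restrictScalars ℝ
      exact ρ.hasStrictFDerivAt.comp px (h1.comp px (jS.hasStrictFDerivAt (x := px)))
    -- `f'` is onto: real targets are hit from the real slice (complex onto at `x` + averaging over the conjugation)
    have hf'onto : (f' : Sr →ₗ[ℝ] (Fin (constrCard 𝔹 k) → EuclideanSpace ℝ (Fin 3))).range = ⊤ := by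
      refine LinearMap.range_eq_top.2 fun y => ?_
      let yc : Fin (constrCard 𝔹 k) → EuclideanSpace ℂ (Fin 3) := fun i => WithLp.toLp 2 fun b => ((y i b : ℝ) : ℂ)
      have hycfix : cF yc = yc := by
        funext i; ext b; rw [hcF]; exact Complex.conj_ofReal _
      obtain ⟨s, hs⟩ := hontox yc
      have hsum_fix : cE ((2 : ℂ)⁻¹ • (s + cE s)) = (2 : ℂ)⁻¹ • (s + cE s) := conj_fix_rePart cE hcEinv s
      obtain ⟨p, hp⟩ := hlift _ hsum_fix
      refine ⟨p, ?_⟩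
      have hL : fderiv ℂ Φ₀ x ((2 : ℂ)⁻¹ • (s + cE s)) = yc := by
        rw [map_smul, map_add, hLeq, hs, hycfix, ← two_smul ℂ yc, smul_smul]; norm_num
      show ρ (((fderiv ℂ Φ₀ x).restrictScalars ℝ) (jS p)) = y
      rw [ContinuousLinearMap.coe_restrictScalars', hp, hL]
      funext i; ext b; rw [hρ]; exact Complex.ofReal_re _
    -- the real kernel vector `u`, lifted to `Sr`
    obtain ⟨pu, hpu⟩ := hlift u hufix
    have huk : f' pu = 0 := show ρ (((fderiv ℂ Φ₀ x).restrictScalars ℝ) (jS pu)) = 0 by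
      rw [ContinuousLinearMap.coe_restrictScalars', hpu, huker, map_zero]
    -- the real IFT curve in the real slice, through `px`, in the fibre of `U'`
    obtain ⟨c, hc0, hcd, hcf⟩ := exists_hasDerivAt_curve_of_mem_ker (f := f) (f' := f') (a := px) hf hf'onto huk
    -- the curve read in `S`, and the chart configurations along it
    have hcS : HasDerivAt (fun t => jS (c t)) u 0 := by
      have h := jS.hasFDerivAt.comp_hasDerivAt (0 : ℝ) hcd; rwa [hpu] at h
    have hcS0 : jS (c 0) = x := by rw [hc0, hpx]
    have hχc : ∀ t, χ (jS (c t)) = coeField (expMul su2Chart (c t : VecField P 0 E3) U₀) := fun t => by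
      show expMulC (((jS (c t) : S) : VecField P 0 (EuclideanSpace ℂ (Fin 3)))) (coeField U₀) = _
      rw [hjS, expMulC_cplxVec_coeField_eq]
    have hct : Tendsto (fun t => jS (c t)) (𝓝 0) (𝓝 x) := by have h := hcS.continuousAt.tendsto; rwa [hcS0] at h
    have hχct : Tendsto (fun t => χ (jS (c t))) (𝓝 0) (𝓝 (coeField U')) := by
      rw [← hχU]; exact (hχan x).continuousAt.tendsto.comp hct
    have hU'0 : expMul su2Chart ((c 0 : Sr) : VecField P 0 E3) U₀ = U' :=
      hcoeinj _ _ (by rw [← hχc 0, hcS0, hχU])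
    -- along the curve, for `t` near `0`: the configuration is in the class and on the fibre of `U'`, so the action is at least `A(U')`
    have hcurveO : ∀ᶠ t in 𝓝 (0 : ℝ), χ (jS (c t)) ∈ O := hχct.eventually (hOopen.mem_nhds (by rw [← hχU]; exact hxO))
    have hgood : ∀ᶠ t in 𝓝 (0 : ℝ), wilsonAction4 U' ≤ wilsonAction4 (expMul su2Chart (c t : VecField P 0 E3) U₀) := by
      filter_upwards [hcf, hcurveO] with t hft hOt
      obtain ⟨hregt, hsbt, hrelt, hrealt, -⟩ := hOG hOt
      -- the coordinates along the curve and at `x` are REAL with EQUAL REAL PARTS (`f (c t) = f px`), hence equal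
      have hκeq : κ (χ (jS (c t))) = κ (coeField U') := by
        refine eq_of_conj_fixed_of_re_eq (fun i b => ?_) (fun i b => ?_) (fun i b => ?_)
        · have hκfixt : cF (κ (χ (jS (c t)))) = κ (χ (jS (c t))) := hrealt _ (hχc t).symm
          have h := congrArg (fun v : Fin (constrCard 𝔹 k) → EuclideanSpace ℂ (Fin 3) => v i b) hκfixt
          simp only at h; rw [hcF] at h; exact h
        · have hκfixU : cF (κ (χ x)) = κ (χ x) := hrealκx U' hχU.symm
          rw [hχU] at hκfixU
          have h := congrArg (fun v : Fin (constrCard 𝔹 k) → EuclideanSpace ℂ (Fin 3) => v i b) hκfixU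
          simp only at h; rw [hcF] at h; exact h
        · have h := congrArg (fun v : Fin (constrCard 𝔹 k) → EuclideanSpace ℝ (Fin 3) => v i b) hft
          have h1 : f (c t) i b = (κ (χ (jS (c t))) i b).re := by
            show ρ (Φ₀ (jS (c t))) i b = _
            rw [hρ, hΦ₀κ]
          have h2 : f px i b = (κ (coeField U') i b).re := by
            show ρ (Φ₀ (jS px)) i b = _
            rw [hρ, hpx, hΦ₀κ, hχU]
          rw [← h1, ← h2]; exact h
      have hagree : AgreeOn 𝔹 (avgFamily av (expMul su2Chart (c t : VecField P 0 E3) U₀)) (avgFamily av U') :=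
        agreeOn_of_datumCoord_eq_of_guardOn 𝔹 k hk W κ hκ h𝔹 (hsbt _ (hχc t).symm) (hsbx U' hχU.symm)
          (fun i => by rw [← hχc t]; exact (hrelt i).le) (fun i => by rw [← hχU]; exact (hrelx i).le) (by rw [← hχc t, hκeq])
      exact hmin'.2.2 _ (hregt _ (hχc t).symm) hagree
    -- Fermat: the action along the curve has a local minimum at `0`
    have hlocmin : IsLocalMin (fun t : ℝ => wilsonAction4 (expMul su2Chart (c t : VecField P 0 E3) U₀)) 0 := by
      refine hgood.mono fun t ht => ?_
      show wilsonAction4 (expMul su2Chart ((c 0 : Sr) : VecField P 0 E3) U₀) ≤ wilsonAction4 (expMul su2Chart (c t : VecField P 0 E3) U₀)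
      rw [hU'0]; exact ht
    -- derivative of the action along the curve = `Re (Da(x) u)`
    have hderiv : HasDerivAt (fun t : ℝ => wilsonAction4 (expMul su2Chart (c t : VecField P 0 E3) U₀)) (fderiv ℂ a x u).re 0 := by
      have ha0 : HasFDerivAt a ((fderiv ℂ a x).restrictScalars ℝ) (jS (c 0)) := by
        rw [hcS0]; exact ((haan x).differentiableAt.hasFDerivAt).restrictScalars ℝ
      have hcomp := ha0.comp_hasDerivAt (0 : ℝ) hcS
      have hfun : (fun t : ℝ => a (jS (c t))) = fun t => ((wilsonAction4 (expMul su2Chart (c t : VecField P 0 E3) U₀) : ℝ) : ℂ) := by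
        funext t
        rw [ha, hjS]
        exact actionSum_expMulC_cplxVec (P := P) (j := 0) (A := fun W => ∑ p : Plaq P 0, (1 - (W ⟨p.src, p.μ⟩ * W ⟨p.src.shift p.μ, p.ν⟩ *
          Matrix.adjugate (W ⟨p.src.shift p.ν, p.μ⟩) * Matrix.adjugate (W ⟨p.src, p.ν⟩)).trace / 2)) (fun _ => rfl) U₀ _
      have hcomp₁ : HasDerivAt (fun t : ℝ => a (jS (c t))) (((fderiv ℂ a x).restrictScalars ℝ) u) 0 := hcomp
      rw [ContinuousLinearMap.coe_restrictScalars', hfun] at hcomp₁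
      have hre := (Complex.reCLM.hasFDerivAt).comp_hasDerivAt (0 : ℝ) hcomp₁
      simpa only [Function.comp_def, Complex.reCLM_apply, Complex.ofReal_re] using hre
    have hre0 : (fderiv ℂ a x u).re = 0 := hlocmin.hasDerivAt_eq_zero hderiv
    -- `Da(x) u` is real
    have him0 : (fderiv ℂ a x u).im = 0 := by
      have h := hlameq u
      rw [hufix] at h
      have h2 := congrArg Complex.im h; rw [Complex.conj_im] at h2; linarith
    exact Complex.ext hre0 him0
  -- ===== real kernel ⇒ complex kernel ⇒ multiplier =====
  have hker : ∀ s : S, fderiv ℂ Φ₀ x s = 0 → fderiv ℂ a x s = 0 :=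
    killsKer_of_real cE cF hcEinv (fderiv ℂ a x) (fderiv ℂ Φ₀ x) hLeq hrealker
  exact exists_multiplier_of_killsKer (fderiv ℂ a x) (fderiv ℂ Φ₀ x) hontox hker

end P8

end Literature.MathematicalPhysics.QuantumFieldTheory.Balaban1983to89.B15Prop1ChartPointCriticalityFromMinimiserTower

end
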